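import Summits.CriticalPhenomena.PercolationContinuityZ3.Theorems.Transplant.FKConnectivityAllQPat3TwoLevelInduction
import HarnessLib

/-!
# Connectivity correlation inequalities for `φ_{w,q}`, every `q > 0` — the S1 gluing steps of `famT12` in HYPOTHESIS form
# (Stage S3, part 5: census g32's one-sided 2-cut law and 1-cut laws for all fourteen members at once)

Theorems file (`--supports stmt-CriticalPhenomena-4575`), census lane `prim-bschramm-census` (gen 36) of the post-continuity programme (LANE 2 bschramm, FK sub-lane);
builds on p205010 (kernel theorem, internal audit signed; external expert review pending).
No definitions, no named facts, no sorries; standard axioms.  The three gluing steps inside `FK.fam_nonneg_of_isTTSP` (file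
`…Pat3TwoLevelInduction.lean`) restated with the «smaller side» validity as a HYPOTHESIS and the other side ARBITRARY — the form
THEOREM 3C's minimal-counterexample induction consumes: **`FK.famT12_par_step`** (2-cut `{x,y}` of two marks = one-sided law),
**`FK.famT12_serR_step`** / **`FK.famT12_serL_step`** (1-cut at an unmarked vertex, marks `2∣1`), **`FK.famT12_serS_step`**
(1-cut at a mark — UNCONDITIONAL).  Each: for every member `famGet famT12 i` (T_sym, STAR×3, C1–C3, S¹C1, S¹C3, mirrors) and every
nonnegative level weight.
[cite: AyyerLinussonRavichandran2025, §7 eq. (13)–(15) (p. 22)] [cite: Grimmett2006, §3.8 (pp. 61–62)]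
-/

noncomputable section

namespace Summit.CriticalPhenomena.PercolationContinuityZ3.Theorems

namespace FK

open SimpleGraph Literature.Probability.LatticeModels Literature.Probability.Percolation

/-! ### The S1 gluing steps of the family `famT12` in HYPOTHESIS form (census g32's one-sided / 1-cut laws for all fourteen members) -/

section FamSteps

open scoped Classical

variable {V : Type*} [Fintype V]

/-- **PARALLEL STEP (the 2-cut `{x, y}` consists of two marks; one-sided law):** `E₂` an `(x, y)`-part carrying the inner
mark `s`, `E₁` ANY `(x, y)`-part meeting it inside `{x, y}`; if all fourteen members of `famT12` are nonnegative on
`(E₂; x, y, s)` for every nonnegative weight, then so is every member on the union. [cite: AyyerLinussonRavichandran2025, §7 (p. 22)] -/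
theorem famT12_par_step {E₁ E₂ : Finset (Sym2 V)} {V₁ V₂ : Set V} (hd : Disjoint E₁ E₂)
    (h₁ : ∀ e ∈ (↑E₁ : Set (Sym2 V)), ∀ z ∈ e, z ∈ V₁) (h₂ : ∀ e ∈ (↑E₂ : Set (Sym2 V)), ∀ z ∈ e, z ∈ V₂)
    {x y s : V} (hS : V₁ ∩ V₂ ⊆ {x, y}) (hxy : x ≠ y) (hsV : s ∉ V₁) (hsx : s ≠ x) (hsy : s ≠ y)
    (ih : ∀ i : ℕ, ∀ w' : ℕ → ℝ, (∀ n, 0 ≤ w' n) → 0 ≤ mval2 w' E₂ x y s (famGet famT12 i))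
    (w : ℕ → ℝ) (hw : ∀ n, 0 ≤ w n) (i : ℕ) : 0 ≤ mval2 w (E₁ ∪ E₂) x y s (famGet famT12 i) := by
  by_cases hi : famT12.length ≤ i
  · rw [famGet_of_le hi, mval2_zero]
  have hi' : i < famT12.length := lt_of_not_ge hi
  exact mval2_par_nonneg hd h₁ h₂ hS hxy hsV hsx hsy
    (G := fun a' a'' => famGet famT12 (selT12Par i a' a'').1) (m := fun a' a'' => (selT12Par i a' a'').2.1)
    (k := fun a' a'' => (selT12Par i a' a'').2.2) (fun a' a'' => (certGlueFam_spec famT12_cert_par hi' a' a'').1)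
    (fun a' a'' => (certGlueFam_spec famT12_cert_par hi' a' a'').2) (fun a' a'' w' hw' => ih _ w' hw') w hw

/-- **SERIES STEP, mark in the first part (the 1-cut at an unmarked vertex `m₀`, marks `x, s ∣ y`):** `E₁` an `(x, m₀)`-part
carrying the inner mark `s`, `E₂` ANY `(m₀, y)`-part; if all members are nonnegative on `(E₁; x, m₀, s)`, then every member is
nonnegative on `(E₁ ∪ E₂; x, y, s)`. [cite: AyyerLinussonRavichandran2025, §7 (p. 22)] -/
theorem famT12_serR_step {E₁ E₂ : Finset (Sym2 V)} {V₁ V₂ : Set V} (hd : Disjoint E₁ E₂)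
    (h₁ : ∀ e ∈ (↑E₁ : Set (Sym2 V)), ∀ z ∈ e, z ∈ V₁) (h₂ : ∀ e ∈ (↑E₂ : Set (Sym2 V)), ∀ z ∈ e, z ∈ V₂)
    {x m₀ y s : V} (hS : V₁ ∩ V₂ ⊆ {m₀}) (hxV : x ∉ V₂) (hsV : s ∉ V₂) (hyV : y ∉ V₁) (hxm : x ≠ m₀) (hym : y ≠ m₀)
    (hxy : x ≠ y) (hsm : s ≠ m₀) (hsy : s ≠ y)
    (ih : ∀ i : ℕ, ∀ w' : ℕ → ℝ, (∀ n, 0 ≤ w' n) → 0 ≤ mval2 w' E₁ x m₀ s (famGet famT12 i))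
    (w : ℕ → ℝ) (hw : ∀ n, 0 ≤ w n) (i : ℕ) : 0 ≤ mval2 w (E₁ ∪ E₂) x y s (famGet famT12 i) := by
  by_cases hi : famT12.length ≤ i
  · rw [famGet_of_le hi, mval2_zero]
  have hi' : i < famT12.length := lt_of_not_ge hi
  exact mval2_serR_nonneg hd h₁ h₂ hS hxV hsV hyV hxm hym hxy hsm hsy
    (G := fun a' a'' => famGet famT12 (selT12SerR i a' a'').1) (m := fun a' a'' => (selT12SerR i a' a'').2.1)
    (k := fun a' a'' => (selT12SerR i a' a'').2.2) (fun a' a'' => (certGlueFam_spec famT12_cert_serR hi' a' a'').1)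
    (fun a' a'' => (certGlueFam_spec famT12_cert_serR hi' a' a'').2) (fun a' a'' w' hw' => ih _ w' hw') w hw

/-- **SERIES STEP, mark in the second part (the 1-cut at an unmarked vertex `m₀`, marks `x ∣ y, s`):** `E₂` an `(m₀, y)`-part
carrying the inner mark `s`, `E₁` ANY `(x, m₀)`-part; if all members are nonnegative on `(E₂; m₀, y, s)`, then every member is
nonnegative on `(E₁ ∪ E₂; x, y, s)`. [cite: AyyerLinussonRavichandran2025, §7 (p. 22)] -/
theorem famT12_serL_step {E₁ E₂ : Finset (Sym2 V)} {V₁ V₂ : Set V} (hd : Disjoint E₁ E₂)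
    (h₁ : ∀ e ∈ (↑E₁ : Set (Sym2 V)), ∀ z ∈ e, z ∈ V₁) (h₂ : ∀ e ∈ (↑E₂ : Set (Sym2 V)), ∀ z ∈ e, z ∈ V₂)
    {x m₀ y s : V} (hS : V₁ ∩ V₂ ⊆ {m₀}) (hxV : x ∉ V₂) (hyV : y ∉ V₁) (hsV : s ∉ V₁) (hxm : x ≠ m₀) (hym : y ≠ m₀)
    (hxy : x ≠ y) (hsm : s ≠ m₀) (hxs : x ≠ s)
    (ih : ∀ i : ℕ, ∀ w' : ℕ → ℝ, (∀ n, 0 ≤ w' n) → 0 ≤ mval2 w' E₂ m₀ y s (famGet famT12 i))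
    (w : ℕ → ℝ) (hw : ∀ n, 0 ≤ w n) (i : ℕ) : 0 ≤ mval2 w (E₁ ∪ E₂) x y s (famGet famT12 i) := by
  by_cases hi : famT12.length ≤ i
  · rw [famGet_of_le hi, mval2_zero]
  have hi' : i < famT12.length := lt_of_not_ge hi
  exact mval2_serL_nonneg hd h₁ h₂ hS hxV hyV hsV hxm hym hxy hsm hxs
    (G := fun a' a'' => famGet famT12 (selT12SerL i a' a'').1) (m := fun a' a'' => (selT12SerL i a' a'').2.1)
    (k := fun a' a'' => (selT12SerL i a' a'').2.2) (fun a' a'' => (certGlueFam_spec famT12_cert_serL hi' a' a'').1)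
    (fun a' a'' => (certGlueFam_spec famT12_cert_serL hi' a' a'').2) (fun a' a'' w' hw' => ih _ w' hw') w hw

/-- **SERIES STEP AT THE MARK (the 1-cut at the mark `s`, marks `x ∣ y`): UNCONDITIONAL** — `E₁` any `(x, s)`-part, `E₂` any
`(s, y)`-part meeting inside `{s}`: every member of `famT12` is nonnegative on `(E₁ ∪ E₂; x, y, s)`.
[cite: AyyerLinussonRavichandran2025, §7 (p. 22)] -/
theorem famT12_serS_step {E₁ E₂ : Finset (Sym2 V)} {V₁ V₂ : Set V} (hd : Disjoint E₁ E₂)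
    (h₁ : ∀ e ∈ (↑E₁ : Set (Sym2 V)), ∀ z ∈ e, z ∈ V₁) (h₂ : ∀ e ∈ (↑E₂ : Set (Sym2 V)), ∀ z ∈ e, z ∈ V₂)
    {x s y : V} (hS : V₁ ∩ V₂ ⊆ {s}) (hxV : x ∉ V₂) (hyV : y ∉ V₁) (hxs : x ≠ s) (hys : y ≠ s) (hxy : x ≠ y)
    (w : ℕ → ℝ) (hw : ∀ n, 0 ≤ w n) (i : ℕ) : 0 ≤ mval2 w (E₁ ∪ E₂) x y s (famGet famT12 i) := by
  by_cases hi : famT12.length ≤ i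
  · rw [famGet_of_le hi, mval2_zero]
  have hi' : i < famT12.length := lt_of_not_ge hi
  exact mval2_serS_nonneg hd h₁ h₂ hS hxV hyV hxs hys hxy (certSerSFam_spec famT12_cert_serS hi') w hw

end FamSteps

end FK

end Summit.CriticalPhenomena.PercolationContinuityZ3.Theorems

end
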